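import Literature.RingTheory.CohomologyAnnihilator.TowerBasic
import Mathlib.LinearAlgebra.Finsupp.Pi
import HarnessLib

/-!
# The compactness lemma `|Add 𝒳|ₙ ∩ mod Λ = |𝒳|ₙ` (Iyengar–Takahashi, Lemma 4.8)

Topic: `Literature/RingTheory/CohomologyAnnihilator`. [IyengarTakahashi2014, §4, "A compactness
argument"]: for a subcategory `𝒳 ⊆ mod Λ`, `Add 𝒳 ⊆ Mod Λ` denotes the direct summands of ARBITRARY
direct sums of copies of modules in `𝒳`, and the construction of Definition 4.1 run in `Mod Λ`
gives the tower `|Add 𝒳|ₙ`. **Lemma 4.8**: for `Λ` noetherian and every `n ≥ 1`,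
`|Add 𝒳|ₙ ∩ mod Λ = |𝒳|ₙ`. It is used in the proof of Theorem 5.4 to descend a strong generator
along `R → R ⊗ₖ K`.

This file, for `𝒳 = {G}` and in the vocabulary of `StrongGenerator.lean`/`TowerBasic.lean`:

* `IsRetractOfCopower G X` — `X ∈ Add G`: `X` is a retract of a copower `G^{(ι)} = ι →₀ G`;
* `InTowerAdd G n M` — `M ∈ |Add G|ₙ`: the clauses of `InTower` with `add G` replaced by `Add G`
  (and the auxiliary summand `W` an arbitrary module);
* `inTowerAdd_of_inTower` — `|G|ₙ ⊆ |Add G|ₙ`;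
* `exists_factor_of_inTowerAdd` — the **Claim** in the proof of Lemma 4.8, in extension form: a
  map `φ : M → Z` from a finitely generated `M` to `Z ∈ |Add G|ₙ` factors through a finitely
  generated `V ∈ |G|ₙ` (induction on `n`; the step is the printed construction: `M → X` factors
  through a finite sub-sum `G^J` of `G^{(ι)}`, a finite free `F ↠ G^J` is lifted into `Z ⊕ W`,
  the kernel `M'` of `M ⊕ F ↠ G^J` maps to `Y ∈ |Add G|ₙ₋₁`, and `V` is the pushout of
  `M' → V'` (inductive factorisation) along `M' ↪ M ⊕ F`, an extension of `V'` by `G^J`);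
* `inTower_of_retract_inTowerAdd` — **Lemma 4.8**: a finitely generated retract of a module in
  `|Add G|ₙ` lies in `|G|ₙ`.

## References

* S. B. Iyengar, R. Takahashi, *Annihilation of cohomology and strong generation of module
  categories*, IMRN 2016; arXiv:1404.1476 — §4, Lemma 4.8 (after [BondalVandenBergh03,
  Prop. 2.2.4], [Rouquier08, Prop. 3.13]). [`IyengarTakahashi2014`]
-/

noncomputable section

open CategoryTheory CategoryTheory.Limits

universe u

namespace Literature.RingTheory.CohomologyAnnihilator

variable {A : Type u} [CommRing A]

/-! ## `Add G` and the tower `|Add G|ₙ` -/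

/-- `X ∈ Add G`: `X` is a direct summand (retract) of a possibly infinite direct sum `G^{(ι)}` of
copies of `G` ("`Add 𝒳` … direct summands of arbitrary direct sums of copies of the modules in
`𝒳`", for `𝒳 = {G}`; the direct sum is realised as `ι →₀ G`).
[cite: IyengarTakahashi2014, §4 (A compactness argument)] -/
def IsRetractOfCopower (G X : ModuleCat.{u} A) : Prop :=
  ∃ (ι : Type u) (i : X ⟶ ModuleCat.of A (ι →₀ G)) (p : ModuleCat.of A (ι →₀ G) ⟶ X),
    i ≫ p = 𝟙 X

/-- `M ∈ |Add G|ₙ`, the tower of Definition 4.1 built in `Mod Λ` out of `Add G`: `|Add G|₀ = {0}`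
and `M ∈ |Add G|ₙ₊₁` iff there is an exact `0 → Y → M ⊕ W → X → 0` with `Y ∈ |Add G|ₙ` and
`X ∈ Add G`. [cite: IyengarTakahashi2014, §4 (A compactness argument)] -/
def InTowerAdd (G : ModuleCat.{u} A) : ℕ → ModuleCat.{u} A → Prop
  | 0, M => IsZero M
  | n + 1, M => ∃ (W Y X : ModuleCat.{u} A), InTowerAdd G n Y ∧ IsRetractOfCopower G X ∧
      ∃ (f : Y ⟶ ModuleCat.of A (M × W)) (g : ModuleCat.of A (M × W) ⟶ X) (w : f ≫ g = 0),
        (ShortComplex.mk f g w).ShortExact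

/-- `add G ⊆ Add G`: a finite power `Gᵐ` is the copower `G^{(Fin m)}`.
[cite: IyengarTakahashi2014, §4 (A compactness argument)] -/
theorem IsRetractOfPower.isRetractOfCopower {G X : ModuleCat.{u} A} (h : IsRetractOfPower G X) :
    IsRetractOfCopower G X := by
  obtain ⟨m, i, p, hip⟩ := h
  let e : ModuleCat.of A (Fin m → G) ≅ ModuleCat.of A (ULift.{u} (Fin m) →₀ G) :=
    ((LinearEquiv.funCongrLeft A G Equiv.ulift) ≪≫ₗ
      (Finsupp.linearEquivFunOnFinite A G (ULift.{u} (Fin m))).symm).toModuleIso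
  refine ⟨ULift.{u} (Fin m), i ≫ e.hom, e.inv ≫ p, ?_⟩
  rw [Category.assoc, e.hom_inv_id_assoc, hip]

/-- `|G|ₙ ⊆ |Add G|ₙ`. [cite: IyengarTakahashi2014, §4 (A compactness argument)] -/
theorem inTowerAdd_of_inTower {G : ModuleCat.{u} A} :
    ∀ {n : ℕ} {M : ModuleCat.{u} A}, InTower G n M → InTowerAdd G n M
  | 0, _, h => h
  | _ + 1, _, ⟨W, Y, X, hY, hX, f, g, w, hS⟩ =>
    ⟨W, Y, X, inTowerAdd_of_inTower hY, hX.isRetractOfCopower, f, g, w, hS⟩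

/-! ## Finiteness: maps from finitely generated modules into copowers -/

/-- A linear map from a finitely generated module into a copower `ι →₀ N` has its image supported
on a finite set of indices. [folklore] -/
private theorem exists_finset_support_subset {M : Type u} [AddCommGroup M] [Module A M]
    [Module.Finite A M] {ι : Type u} {N : Type u} [AddCommGroup N] [Module A N]
    (χ : M →ₗ[A] (ι →₀ N)) : ∃ s : Finset ι, ∀ m : M, (χ m).support ⊆ s := by
  classical
  obtain ⟨t, ht⟩ := Module.Finite.fg_top (R := A) (M := M)
  refine ⟨t.biUnion fun x => (χ x).support, fun m => ?_⟩
  have hm : m ∈ Submodule.span A (t : Set M) := by rw [ht]; exact Submodule.mem_top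
  induction hm using Submodule.span_induction with
  | mem x hx =>
    exact Finset.subset_biUnion_of_mem (fun x => (χ x).support) (Finset.mem_coe.mp hx)
  | zero => simp
  | add x y _ _ hx hy =>
    rw [map_add]
    exact Finsupp.support_add.trans (Finset.union_subset hx hy)
  | smul r x _ hx =>
    rw [map_smul]
    exact Finsupp.support_smul.trans hx

/-! ## The Claim of the proof of Lemma 4.8 -/

/-- **The Claim in the proof of [IyengarTakahashi2014, Lemma 4.8]** (extension form): over a
noetherian ring, for `G` finitely generated, every map `φ : M → Z` from a finitely generated module
`M` to a module `Z ∈ |Add G|ₙ` factors as `M → V → Z` with `V` finitely generated and in `|G|ₙ`.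
Induction on `n`; for `Z` given by `0 → Y → Z ⊕ W → X → 0` (`Y ∈ |Add G|ₙ₋₁`, `X` a retract of
`G^{(ι)}`): the composite `M → X → G^{(ι)}` lands in a finite sub-sum `G^J`, so `M → X` factors
through `X' = G^J ∈ add G`; choose a finite free `ε : F ↠ X'` and a lift `κ : F → Z ⊕ W` of
`F → X' → X`; the kernel `M'` of `M ⊕ F ↠ X'` is finitely generated and maps to `Y`, so by
induction `M' → Y` factors through a finitely generated `V' ∈ |G|ₙ₋₁`; the pushout `V` of
`M' → V'` along `M' ↪ M ⊕ F` is an extension `0 → V' → V → X' → 0`, hence finitely generated and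
in `|G|ₙ`, and `M → M ⊕ F → V → Z` is the required factorisation ("set
`Wᵢ := Mᵢ ⊕ Fⁱ ⊕ ⋯ ⊕ F¹` … the composition `Mₙ → Wₙ → Zₙ` is precisely `φ`").
[cite: IyengarTakahashi2014, Lemma 4.8 (proof, Claim)] -/
theorem exists_factor_of_inTowerAdd [IsNoetherianRing A] {G : ModuleCat.{u} A}
    [Module.Finite A G] :
    ∀ (n : ℕ) {Z : ModuleCat.{u} A}, InTowerAdd G n Z → ∀ (M : ModuleCat.{u} A) (_ : Module.Finite A M)
      (φ : M ⟶ Z), ∃ V : ModuleCat.{u} A, Module.Finite A V ∧ InTower G n V ∧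
        ∃ (α : M ⟶ V) (β : V ⟶ Z), α ≫ β = φ
  | 0, Z, hZ, M, _, φ =>
    ⟨ModuleCat.of A PUnit.{u + 1}, inferInstance, ModuleCat.isZero_of_subsingleton _, 0, 0, by
      rw [zero_comp]; exact (hZ.eq_of_tgt 0 φ)⟩
  | n + 1, Z, ⟨W, Y, X, hY, ⟨ι, i, p, hip⟩, f, g, w, hS⟩, M, hM, φ => by
    classical
    obtain ⟨hf, hg, hfg⟩ := shortExact_unpack hS
    -- `φ' : M → Z ⊕ W`, `ψ : M → X`, `χ : M → G^{(ι)}`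
    let φ' : M →ₗ[A] (Z × W) := LinearMap.inl A Z W ∘ₗ φ.hom
    let ψ : M →ₗ[A] X := g.hom ∘ₗ φ'
    let χ : M →ₗ[A] (ι →₀ G) := i.hom ∘ₗ ψ
    have hpi : ∀ x : X, p.hom (i.hom x) = x := retract_apply hip
    -- a finite sub-sum `G^s` receiving `χ`
    obtain ⟨s, hs⟩ := exists_finset_support_subset χ
    let resS : (ι →₀ G) →ₗ[A] (s → G) := LinearMap.pi fun j : s => Finsupp.lapply (j : ι)
    let extS : (s → G) →ₗ[A] (ι →₀ G) :=
      ∑ j : s, (Finsupp.lsingle (j : ι)).comp (LinearMap.proj j)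
    have hext : ∀ v : ι →₀ G, v.support ⊆ s → extS (resS v) = v := by
      intro v hv
      simp only [extS, resS, LinearMap.coe_sum, Finset.sum_apply, LinearMap.comp_apply,
        LinearMap.proj_apply, LinearMap.pi_apply, Finsupp.lapply_apply, Finsupp.lsingle_apply]
      rw [Finset.sum_coe_sort s (fun a => Finsupp.single a (v a)),
        ← Finsupp.sum_of_support_subset v hv (fun a b => Finsupp.single a b)
          (fun a _ => Finsupp.single_zero a)]
      exact Finsupp.sum_single v
    -- `X' = G^s ∈ add G`, `ψ₀ : M → X'`, `θ : X' → X` with `θ ∘ ψ₀ = ψ`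
    let X' : ModuleCat.{u} A := ModuleCat.of A (s → G)
    have hX' : IsRetractOfPower G X' :=
      ((isRetractOfPower_self G).pi (Fintype.card s)).of_iso
        (LinearEquiv.funCongrLeft A G (Fintype.equivFin s)).toModuleIso
    let ψ₀ : M →ₗ[A] (s → G) := resS ∘ₗ χ
    let θ : (s → G) →ₗ[A] X := p.hom ∘ₗ extS
    have hθψ₀ : ∀ m : M, θ (ψ₀ m) = ψ m := fun m => by
      change p.hom (extS (resS (χ m))) = ψ m
      rw [hext (χ m) (hs m)]
      exact hpi (ψ m)
    -- a finite free cover `π : F ↠ X'` and a lift `κ : F → Z ⊕ W` of `θ ∘ π` through `g`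
    obtain ⟨c, π, hπ⟩ := Module.Finite.exists_fin' A (s → G)
    obtain ⟨κ, hκ⟩ := Module.projective_lifting_property g.hom (θ ∘ₗ π) hg
    have hκ' : ∀ v, g.hom (κ v) = θ (π v) := fun v => LinearMap.congr_fun hκ v
    -- `Φ : M ⊕ F → Z ⊕ W` over `Ψ : M ⊕ F ↠ X'`
    let Φ : (M × (Fin c → A)) →ₗ[A] (Z × W) := φ'.coprod κ
    let Ψ : (M × (Fin c → A)) →ₗ[A] (s → G) := ψ₀.coprod π
    have hΦΨ : ∀ x, g.hom (Φ x) = θ (Ψ x) := fun x => by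
      obtain ⟨m, v⟩ := x
      change g.hom (φ' m + κ v) = θ (ψ₀ m + π v)
      rw [map_add, map_add, hκ', hθψ₀]
      rfl
    have hΨ : Function.Surjective Ψ := fun x => by
      obtain ⟨v, hv⟩ := hπ x
      exact ⟨(0, v), by simp [Ψ, hv]⟩
    -- the kernel `M'` and its map `φ'' : M' → Y`
    let M' := LinearMap.ker Ψ
    haveI : Module.Finite A M := hM
    haveI : Module.Finite A M' := Module.IsNoetherian.finite A _
    have hmem : ∀ x : M', Φ x.1 ∈ LinearMap.range f.hom := fun x =>
      LinearMap.mem_range.mpr ((hfg _).1 (by rw [hΦΨ, show Ψ x.1 = 0 from x.2, map_zero]))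
    let eR := LinearEquiv.ofInjective f.hom hf
    let φ'' : M' →ₗ[A] Y := eR.symm.toLinearMap ∘ₗ
      LinearMap.codRestrict (LinearMap.range f.hom) (Φ ∘ₗ M'.subtype) hmem
    have hφ'' : ∀ x : M', f.hom (φ'' x) = Φ x.1 := fun x => by
      have h := congrArg Subtype.val (eR.apply_symm_apply ⟨Φ x.1, hmem x⟩)
      rw [LinearEquiv.ofInjective_apply] at h
      exact h
    -- inductive factorisation `M' → V' → Y`
    obtain ⟨V', hV'fin, hV'T, α', β', hαβ'⟩ :=
      exists_factor_of_inTowerAdd n hY (ModuleCat.of A M') inferInstance (ModuleCat.ofHom φ'')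
    haveI := hV'fin
    have hαβ'x : ∀ x : M', β'.hom (α'.hom x) = φ'' x := fun x => by
      have := congrArg (fun k => k.hom x) hαβ'
      simpa [ModuleCat.hom_comp] using this
    -- the pushout `V = (V' ⊕ (M ⊕ F)) / {(α' x, -x)}`
    let δ : M' →ₗ[A] (V' × (M × (Fin c → A))) := α'.hom.prod (-M'.subtype)
    let L : Submodule A (V' × (M × (Fin c → A))) := LinearMap.range δ
    let V : ModuleCat.{u} A := ModuleCat.of A ((V' × (M × (Fin c → A))) ⧸ L)
    haveI : Module.Finite A V := by
      change Module.Finite A ((V' × (M × (Fin c → A))) ⧸ L)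
      infer_instance
    -- `0 → V' → V → X' → 0`
    let jV : V' →ₗ[A] ((V' × (M × (Fin c → A))) ⧸ L) := L.mkQ ∘ₗ LinearMap.inl A _ _
    have hLq : L ≤ LinearMap.ker (Ψ ∘ₗ LinearMap.snd A V' _) := by
      rintro _ ⟨x, rfl⟩
      simp [δ, show Ψ x.1 = 0 from x.2]
    let q : ((V' × (M × (Fin c → A))) ⧸ L) →ₗ[A] (s → G) := L.liftQ (Ψ ∘ₗ LinearMap.snd A V' _) hLq
    have hq : ∀ y : V' × (M × (Fin c → A)), q (L.mkQ y) = Ψ y.2 := fun y => rfl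
    have hjV_inj : Function.Injective jV := by
      intro a b hab
      have h0 : L.mkQ ((a - b, 0) : V' × (M × (Fin c → A))) = 0 := by
        have : ((a - b, 0) : V' × (M × (Fin c → A))) = (a, 0) - (b, 0) := by simp
        rw [this, map_sub]
        exact sub_eq_zero.mpr hab
      rw [Submodule.mkQ_apply, Submodule.Quotient.mk_eq_zero] at h0
      obtain ⟨x, hx⟩ := h0
      have hx2 : -(x.1) = 0 := by simpa [δ] using congrArg Prod.snd hx
      have hx0 : x = 0 := Subtype.ext (neg_eq_zero.mp hx2)
      have hx1 : α'.hom x = a - b := by simpa [δ] using congrArg Prod.fst hx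
      rw [hx0, map_zero] at hx1
      exact (sub_eq_zero.mp hx1.symm)
    have hq_surj : Function.Surjective q := fun x => by
      obtain ⟨y, hy⟩ := hΨ x
      exact ⟨L.mkQ (0, y), by rw [hq]; exact hy⟩
    have hexact : Function.Exact jV q := by
      intro z
      constructor
      · intro hz
        induction z using Submodule.Quotient.induction_on with
        | _ y =>
          have hy : Ψ y.2 = 0 := by rwa [← hq y]
          refine ⟨y.1 + α'.hom ⟨y.2, hy⟩, ?_⟩
          change L.mkQ (y.1 + α'.hom ⟨y.2, hy⟩, 0) = L.mkQ y
          rw [← sub_eq_zero, ← map_sub, Submodule.mkQ_apply, Submodule.Quotient.mk_eq_zero]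
          refine ⟨⟨y.2, hy⟩, ?_⟩
          obtain ⟨y1, y2⟩ := y
          simp [δ]
      · rintro ⟨a, rfl⟩
        change q (L.mkQ (a, 0)) = 0
        rw [hq, map_zero]
    obtain ⟨wV, hSV⟩ := exists_shortExact_of_linearMap (Y := V') (M := V) (X := X') jV q
      hjV_inj hq_surj hexact
    have hVT : InTower G (n + 1) V := inTower_succ_of_shortExact hV'T hX' hSV
    -- `α : M → V`, `β : V → Z`
    let αl : M →ₗ[A] ((V' × (M × (Fin c → A))) ⧸ L) :=
      L.mkQ ∘ₗ LinearMap.inr A V' _ ∘ₗ LinearMap.inl A M _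
    let B : (V' × (M × (Fin c → A))) →ₗ[A] Z :=
      (LinearMap.fst A Z W ∘ₗ f.hom ∘ₗ β'.hom).coprod (LinearMap.fst A Z W ∘ₗ Φ)
    have hLB : L ≤ LinearMap.ker B := by
      rintro _ ⟨x, rfl⟩
      rw [LinearMap.mem_ker]
      change (LinearMap.fst A Z W) (f.hom (β'.hom (α'.hom x))) +
        (LinearMap.fst A Z W) (Φ (-(x.1))) = 0
      rw [hαβ'x, hφ'', map_neg, map_neg, add_neg_cancel]
    let βl : ((V' × (M × (Fin c → A))) ⧸ L) →ₗ[A] Z := L.liftQ B hLB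
    refine ⟨V, inferInstance, hVT, ModuleCat.ofHom αl, ModuleCat.ofHom βl, ?_⟩
    apply ModuleCat.hom_ext
    refine LinearMap.ext fun m => ?_
    change B ((0 : V'), (m, (0 : Fin c → A))) = φ.hom m
    simp [B, Φ, φ']

/-! ## Lemma 4.8 -/

/-- **[IyengarTakahashi2014, Lemma 4.8]** (`|Add 𝒳|ₙ ∩ mod Λ = |𝒳|ₙ` for `𝒳 = {G}`, the inclusion
`⊆`; the other is `inTowerAdd_of_inTower`): over a noetherian ring, a finitely generated module
`M` which is a direct summand of a module `Z ∈ |Add G|ₙ` (in particular a finitely generated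
`M ∈ |Add G|ₙ`) lies in `|G|ₙ`. Proof: the split monomorphism `M → Z` factors through a finitely
generated `V ∈ |G|ₙ` by the Claim, and `M` is then a retract of `V`.
[cite: IyengarTakahashi2014, Lemma 4.8] -/
theorem inTower_of_retract_inTowerAdd [IsNoetherianRing A] {G : ModuleCat.{u} A}
    [Module.Finite A G] {n : ℕ} {M Z : ModuleCat.{u} A} [Module.Finite A M]
    (hZ : InTowerAdd G n Z) (i : M ⟶ Z) (p : Z ⟶ M) (hip : i ≫ p = 𝟙 M) : InTower G n M := by
  obtain ⟨V, -, hVT, α, β, h⟩ := exists_factor_of_inTowerAdd n hZ M ‹_› i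
  exact hVT.of_retract α (β ≫ p) (by rw [← Category.assoc, h, hip])

/-- **[IyengarTakahashi2014, Lemma 4.8]**, as an equivalence for finitely generated modules over a
noetherian ring: `M ∈ |Add G|ₙ ↔ M ∈ |G|ₙ`. [cite: IyengarTakahashi2014, Lemma 4.8] -/
theorem inTowerAdd_iff_inTower [IsNoetherianRing A] {G : ModuleCat.{u} A} [Module.Finite A G]
    {n : ℕ} {M : ModuleCat.{u} A} [Module.Finite A M] : InTowerAdd G n M ↔ InTower G n M :=
  ⟨fun h => inTower_of_retract_inTowerAdd h (𝟙 M) (𝟙 M) (Category.comp_id _),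
    inTowerAdd_of_inTower⟩

end Literature.RingTheory.CohomologyAnnihilator

end
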